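import Literature.NumberTheory.Automorphic.CongruenceSubgroupPropertySL2
import HarnessLib

/-!
# Serre's congruence subgroup property for `SL₂(𝓞_F)`, `F` totally real of degree `≥ 2` — proofs, I:
# the group-theoretic shell (Serre 1970 Prop. 1; Vaserstein 1972, reduction to `G(𝔮, A) = E(𝔮, A)`)

Topic `Literature/NumberTheory/Automorphic`; namespace `Literature.NumberTheory.Automorphic`
(grouping sub-namespace `SL2Rel` for Vaserstein's relative groups of `SL₂` over a commutative ring).
Everything here is PROVED; no named facts are introduced.

This is the first file of the proof of the tree's named fact
`SerreSL2Congruence1970_congruenceSubgroupProperty` (J.-P. Serre, *Le problème des groupes de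
congruence pour SL₂*, Ann. of Math. 92 (1970), §2.6 Théorème 2 (b) and Corollaire 3: "Si `S` n'est
pas totalement imaginaire, on a `Γ_𝔮 = E_𝔮` pour tout `𝔮`; tout sous-groupe `S`-arithmétique de
`G` est un groupe de `S`-congruence").  Serre's printed proof of Théorème 2 rests on C. Moore's
determination of the relative fundamental group `π₁(Ḡ, G)` (*Group extensions of `p`-adic and
adelic linear groups*, Publ. IHES 35 (1968), Th. 12.3), which is not available; the tree follows
instead the Moore-free printed route

* L. N. Vaserstein, *О группе `SL₂` над дедекиндовыми кольцами арифметического типа*, Mat. Sb.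
  89 (131) (1972) 313–322 (= Math. USSR Sb. 18 (1972) 321–332), Theorem and Lemmas 1–5: for a
  Dedekind ring of arithmetic type `A` with infinitely many units and non-zero ideals `I₁, I₂`,
  `E(I₁, I₂) ◁ G(I₁, I₂)` and the first-row symbol `W(I₁, I₂) → G(I₁, I₂)/E(I₁, I₂)` is a Mennicke
  symbol ("мы не используем результатов работ [3], [4]" — [4] = Moore);
* H. Bass, J. Milnor, J.-P. Serre, *Solution of the congruence subgroup problem for `SLₙ (n ≥ 3)`
  and `Sp₂ₙ (n ≥ 2)`*, Publ. IHES 33 (1967), Ch. I, Thm. 3.6: if `A` is not totally imaginary, all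
  Mennicke symbols on `W_𝔮` are trivial;

whence `G(𝔮, A) = E(𝔮, A)` for every `𝔮 ≠ 0`, which by the present file gives the property.

## This file (pure algebra over a commutative ring `R`, then `R = 𝓞 F`)

* `SL2Rel.e12 x = (1 x; 0 1)`, `SL2Rel.e21 y = (1 0; y 1)`;
  `SL2Rel.relE I₁ I₂ = ⟨e12 I₁, e21 I₂⟩` (Vaserstein's `E(I₁, I₂)`, the subgroup GENERATED — not
  the normal closure); `SL2Rel.relG I₁ I₂ = {(a b; c d) : b ∈ I₁, c ∈ I₂, a - 1, d - 1 ∈ I₁I₂}`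
  (Vaserstein's `G(I₁, I₂)`); `SL2Rel.Gamma I = ker (SL₂(R) → SL₂(R/I))` (Serre's `Γ_𝔮`, the
  group in the statement of the fact). [cite: Vaserstein1972SL2, p. 313]
* `SL2Rel.Gamma_inf_relE_top_le_normalClosure` — `Γ(I) ∩ E(I, R) ≤` the normal closure `Ê_I`
  of `E(I, I)` in `SL₂(R)` (Vaserstein, p. 315: `E(I, K) ∩ G_I = E_I`; here only `⊆`, by the
  elementary remark that `E(I, R) = Ê_I · e21(R)`).
* `SL2Rel.relE_span_natCast_le` — **Serre's Proposition 1** (§1.4): a subgroup of finite index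
  `H ≤ SL₂(𝓞_F)` contains `E(eA, eA)`, `e = [SL₂ : core H]` (as `gᵉ ∈ core H`).
* `congruenceSubgroupProperty_of_relG_le_relE` — **the reduction**: if `G(e𝓞_F, 𝓞_F) ≤
  E(e𝓞_F, 𝓞_F)` for every totally real `F` of degree `≥ 2` and every integer `e ≥ 1`, then
  `SerreSL2Congruence1970_congruenceSubgroupProperty` holds (with `𝔪 = e𝓞_F`,
  `e = [SL₂(𝓞_F) : core H]`: `Γ(𝔪) ≤ G(𝔪, 𝓞_F) = E(𝔪, 𝓞_F)`, so `Γ(𝔪) ≤ Ê_𝔪 ≤ core H ≤ H`).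

## References

* [SerreSL2Congruence1970] J.-P. Serre, Ann. of Math. (2) 92 (1970) 489–527, §1.4 Prop. 1,
  §2.6 Thm. 2, Cor. 3 (Oeuvres II, no. 86).
* [Vaserstein1972SL2] L. N. Vaserstein, Mat. Sb. 89 (131) (1972) 313–322.
* [BassMilnorSerre1967] H. Bass, J. Milnor, J.-P. Serre, Publ. Math. IHES 33 (1967) 59–137,
  Ch. I §§2–3.
-/

open Matrix MatrixGroups NumberField

namespace Literature.NumberTheory.Automorphic

namespace SL2Rel

variable {R : Type*} [CommRing R]

/-! ### Entries of products and inverses in `SL₂(R)` -/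

/-- Entries of a product in `SL₂(R)`. [folklore] -/
theorem mul_apply_two (M N : SL(2, R)) (i j : Fin 2) :
    (M * N) i j = M i 0 * N 0 j + M i 1 * N 1 j := by
  change ((M : Matrix (Fin 2) (Fin 2) R) * (N : Matrix (Fin 2) (Fin 2) R)) i j = _
  rw [Matrix.mul_apply, Fin.sum_univ_two]

/-- Entries of an inverse in `SL₂(R)`. [folklore] -/
theorem inv_apply_two (M : SL(2, R)) :
    (M⁻¹) 0 0 = M 1 1 ∧ (M⁻¹) 0 1 = -M 0 1 ∧ (M⁻¹) 1 0 = -M 1 0 ∧ (M⁻¹) 1 1 = M 0 0 := by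
  simp [Matrix.adjugate_fin_two]

/-- `(1)₀₀ = 1` in `SL₂(R)`. [folklore] -/
@[simp] theorem one_apply_00 : (1 : SL(2, R)) 0 0 = 1 := rfl
/-- `(1)₀₁ = 0` in `SL₂(R)`. [folklore] -/
@[simp] theorem one_apply_01 : (1 : SL(2, R)) 0 1 = 0 := rfl
/-- `(1)₁₀ = 0` in `SL₂(R)`. [folklore] -/
@[simp] theorem one_apply_10 : (1 : SL(2, R)) 1 0 = 0 := rfl
/-- `(1)₁₁ = 1` in `SL₂(R)`. [folklore] -/
@[simp] theorem one_apply_11 : (1 : SL(2, R)) 1 1 = 1 := rfl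

/-! ### Elementary matrices -/

/-- The upper elementary matrix `E₁₂(x) = (1 x; 0 1)`. [folklore] -/
def e12 (x : R) : SL(2, R) := ⟨!![1, x; 0, 1], by simp [Matrix.det_fin_two_of]⟩

/-- The lower elementary matrix `E₂₁(y) = (1 0; y 1)`. [folklore] -/
def e21 (y : R) : SL(2, R) := ⟨!![1, 0; y, 1], by simp [Matrix.det_fin_two_of]⟩

/-- `E₁₂(x)₀₀ = 1`. [folklore] -/
@[simp] theorem e12_apply_00 (x : R) : (e12 x : SL(2, R)) 0 0 = 1 := rfl
/-- `E₁₂(x)₀₁ = x`. [folklore] -/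
@[simp] theorem e12_apply_01 (x : R) : (e12 x : SL(2, R)) 0 1 = x := rfl
/-- `E₁₂(x)₁₀ = 0`. [folklore] -/
@[simp] theorem e12_apply_10 (x : R) : (e12 x : SL(2, R)) 1 0 = 0 := rfl
/-- `E₁₂(x)₁₁ = 1`. [folklore] -/
@[simp] theorem e12_apply_11 (x : R) : (e12 x : SL(2, R)) 1 1 = 1 := rfl
/-- `E₂₁(y)₀₀ = 1`. [folklore] -/
@[simp] theorem e21_apply_00 (y : R) : (e21 y : SL(2, R)) 0 0 = 1 := rfl
/-- `E₂₁(y)₀₁ = 0`. [folklore] -/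
@[simp] theorem e21_apply_01 (y : R) : (e21 y : SL(2, R)) 0 1 = 0 := rfl
/-- `E₂₁(y)₁₀ = y`. [folklore] -/
@[simp] theorem e21_apply_10 (y : R) : (e21 y : SL(2, R)) 1 0 = y := rfl
/-- `E₂₁(y)₁₁ = 1`. [folklore] -/
@[simp] theorem e21_apply_11 (y : R) : (e21 y : SL(2, R)) 1 1 = 1 := rfl

/-- `E₁₂(0) = 1`. [folklore] -/
@[simp] theorem e12_zero : (e12 0 : SL(2, R)) = 1 := by
  ext i j; fin_cases i <;> fin_cases j <;> rfl

/-- `E₂₁(0) = 1`. [folklore] -/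
@[simp] theorem e21_zero : (e21 0 : SL(2, R)) = 1 := by
  ext i j; fin_cases i <;> fin_cases j <;> rfl

/-- `E₁₂(x + y) = E₁₂(x) E₁₂(y)`. [folklore] -/
theorem e12_add (x y : R) : (e12 (x + y) : SL(2, R)) = e12 x * e12 y := by
  ext i j; fin_cases i <;> fin_cases j <;> simp [mul_apply_two, add_comm]

/-- `E₂₁(x + y) = E₂₁(x) E₂₁(y)`. [folklore] -/
theorem e21_add (x y : R) : (e21 (x + y) : SL(2, R)) = e21 x * e21 y := by
  ext i j; fin_cases i <;> fin_cases j <;> simp [mul_apply_two, add_comm]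

/-- `x ↦ E₁₂(x)` as a homomorphism from `(R, +)`. [folklore] -/
def e12Hom : Multiplicative R →* SL(2, R) where
  toFun x := e12 x.toAdd
  map_one' := e12_zero
  map_mul' _ _ := e12_add _ _

/-- `e12Hom x = E₁₂(x)`. [folklore] -/
@[simp] theorem e12Hom_apply (x : Multiplicative R) : e12Hom x = e12 x.toAdd := rfl

/-- `y ↦ E₂₁(y)` as a homomorphism from `(R, +)`. [folklore] -/
def e21Hom : Multiplicative R →* SL(2, R) where
  toFun y := e21 y.toAdd
  map_one' := e21_zero
  map_mul' _ _ := e21_add _ _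

/-- `e21Hom y = E₂₁(y)`. [folklore] -/
@[simp] theorem e21Hom_apply (y : Multiplicative R) : e21Hom y = e21 y.toAdd := rfl

/-- `E₁₂(n x) = E₁₂(x)ⁿ`. [folklore] -/
theorem e12_nsmul (n : ℕ) (x : R) : (e12 (n • x) : SL(2, R)) = e12 x ^ n := by
  have h := (e12Hom (R := R)).map_pow (Multiplicative.ofAdd x) n
  rw [← ofAdd_nsmul] at h
  simpa only [e12Hom_apply, toAdd_ofAdd] using h

/-- `E₂₁(n x) = E₂₁(x)ⁿ`. [folklore] -/
theorem e21_nsmul (n : ℕ) (x : R) : (e21 (n • x) : SL(2, R)) = e21 x ^ n := by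
  have h := (e21Hom (R := R)).map_pow (Multiplicative.ofAdd x) n
  rw [← ofAdd_nsmul] at h
  simpa only [e21Hom_apply, toAdd_ofAdd] using h

/-- `E₁₂(-x) = E₁₂(x)⁻¹`. [folklore] -/
theorem e12_neg (x : R) : (e12 (-x) : SL(2, R)) = (e12 x)⁻¹ :=
  eq_inv_of_mul_eq_one_left (by rw [← e12_add, neg_add_cancel, e12_zero])

/-- `E₂₁(-y) = E₂₁(y)⁻¹`. [folklore] -/
theorem e21_neg (y : R) : (e21 (-y) : SL(2, R)) = (e21 y)⁻¹ :=
  eq_inv_of_mul_eq_one_left (by rw [← e21_add, neg_add_cancel, e21_zero])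

/-! ### Vaserstein's groups `E(I₁, I₂) ⊆ G(I₁, I₂)` and the principal congruence subgroup -/

/-- Vaserstein's `E(I₁, I₂)`: the subgroup of `SL₂(R)` GENERATED by the `E₁₂(x)`, `x ∈ I₁`, and the
`E₂₁(y)`, `y ∈ I₂`. [cite: Vaserstein1972SL2, p. 313] -/
def relE (I₁ I₂ : Ideal R) : Subgroup SL(2, R) :=
  Subgroup.closure ((e12 '' (I₁ : Set R)) ∪ (e21 '' (I₂ : Set R)))

/-- Vaserstein's `G(I₁, I₂) = {(a b; c d) ∈ SL₂(R) : b ∈ I₁, c ∈ I₂, a - 1, d - 1 ∈ I₁ I₂}`.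
[cite: Vaserstein1972SL2, p. 313] -/
def relG (I₁ I₂ : Ideal R) : Subgroup SL(2, R) where
  carrier := {M | M 0 1 ∈ I₁ ∧ M 1 0 ∈ I₂ ∧ M 0 0 - 1 ∈ I₁ * I₂ ∧ M 1 1 - 1 ∈ I₁ * I₂}
  one_mem' := by
    change (1 : SL(2, R)) 0 1 ∈ I₁ ∧ (1 : SL(2, R)) 1 0 ∈ I₂ ∧ (1 : SL(2, R)) 0 0 - 1 ∈ I₁ * I₂ ∧
      (1 : SL(2, R)) 1 1 - 1 ∈ I₁ * I₂
    simp
  mul_mem' {M N} hM hN := by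
    obtain ⟨hM01, hM10, hM00, hM11⟩ := hM
    obtain ⟨hN01, hN10, hN00, hN11⟩ := hN
    change (M * N) 0 1 ∈ I₁ ∧ (M * N) 1 0 ∈ I₂ ∧ (M * N) 0 0 - 1 ∈ I₁ * I₂ ∧
      (M * N) 1 1 - 1 ∈ I₁ * I₂
    simp only [mul_apply_two]
    refine ⟨?_, ?_, ?_, ?_⟩
    · have : M 0 0 * N 0 1 + M 0 1 * N 1 1 = N 0 1 + (M 0 0 - 1) * N 0 1 + M 0 1 * N 1 1 := by ring
      rw [this]
      exact I₁.add_mem (I₁.add_mem hN01 (I₁.mul_mem_left _ hN01)) (I₁.mul_mem_right _ hM01)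
    · have : M 1 0 * N 0 0 + M 1 1 * N 1 0 = M 1 0 + M 1 0 * (N 0 0 - 1) + M 1 1 * N 1 0 := by ring
      rw [this]
      exact I₂.add_mem (I₂.add_mem hM10 (I₂.mul_mem_right _ hM10)) (I₂.mul_mem_left _ hN10)
    · have : M 0 0 * N 0 0 + M 0 1 * N 1 0 - 1 =
          (M 0 0 - 1) * (N 0 0 - 1) + (M 0 0 - 1) + (N 0 0 - 1) + M 0 1 * N 1 0 := by ring
      rw [this]
      exact Ideal.add_mem _ (Ideal.add_mem _ (Ideal.add_mem _ (Ideal.mul_mem_left _ _ hN00) hM00)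
        hN00) (Ideal.mul_mem_mul hM01 hN10)
    · have : M 1 0 * N 0 1 + M 1 1 * N 1 1 - 1 =
          M 1 0 * N 0 1 + ((M 1 1 - 1) * (N 1 1 - 1) + (M 1 1 - 1) + (N 1 1 - 1)) := by ring
      rw [this, mul_comm (M 1 0)]
      exact Ideal.add_mem _ (Ideal.mul_mem_mul hN01 hM10)
        (Ideal.add_mem _ (Ideal.add_mem _ (Ideal.mul_mem_left _ _ hN11) hM11) hN11)
  inv_mem' {M} hM := by
    obtain ⟨hM01, hM10, hM00, hM11⟩ := hM
    obtain ⟨h00, h01, h10, h11⟩ := inv_apply_two M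
    change (M⁻¹) 0 1 ∈ I₁ ∧ (M⁻¹) 1 0 ∈ I₂ ∧ (M⁻¹) 0 0 - 1 ∈ I₁ * I₂ ∧ (M⁻¹) 1 1 - 1 ∈ I₁ * I₂
    rw [h00, h01, h10, h11]
    exact ⟨I₁.neg_mem hM01, I₂.neg_mem hM10, hM11, hM00⟩

/-- Membership in `G(I₁, I₂)`. [cite: Vaserstein1972SL2, p. 313] -/
theorem mem_relG {I₁ I₂ : Ideal R} {M : SL(2, R)} :
    M ∈ relG I₁ I₂ ↔ M 0 1 ∈ I₁ ∧ M 1 0 ∈ I₂ ∧ M 0 0 - 1 ∈ I₁ * I₂ ∧ M 1 1 - 1 ∈ I₁ * I₂ :=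
  Iff.rfl

/-- The principal congruence subgroup `Γ(I) = ker (SL₂(R) → SL₂(R/I))` (Serre's `Γ_𝔮`).
[cite: SerreSL2Congruence1970, §1.2] -/
def Gamma (I : Ideal R) : Subgroup SL(2, R) :=
  (Matrix.SpecialLinearGroup.map (Ideal.Quotient.mk I)).ker

/-- `Γ(I)` is normal (a kernel). [folklore] -/
instance (I : Ideal R) : (Gamma I).Normal := by
  unfold Gamma; infer_instance

/-- Membership in `Γ(I)`: `b, c ∈ I` and `a ≡ d ≡ 1 (mod I)`. [cite: SerreSL2Congruence1970, §1.2] -/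
theorem mem_Gamma {I : Ideal R} {M : SL(2, R)} :
    M ∈ Gamma I ↔ M 0 1 ∈ I ∧ M 1 0 ∈ I ∧ M 0 0 - 1 ∈ I ∧ M 1 1 - 1 ∈ I := by
  have h1 : ∀ x : R, Ideal.Quotient.mk I x = 1 ↔ x - 1 ∈ I := fun x ↦ by
    rw [← (Ideal.Quotient.mk I).map_one, Ideal.Quotient.eq]
  have key : ∀ i j, (SpecialLinearGroup.map (Ideal.Quotient.mk I) M) i j =
      Ideal.Quotient.mk I (M i j) := fun i j ↦ rfl
  rw [Gamma, MonoidHom.mem_ker]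
  constructor
  · intro h
    have e : ∀ i j, Ideal.Quotient.mk I (M i j) = (1 : SL(2, R ⧸ I)) i j := fun i j ↦ by
      rw [← key, h]
    refine ⟨?_, ?_, ?_, ?_⟩
    · simpa [Ideal.Quotient.eq_zero_iff_mem] using e 0 1
    · simpa [Ideal.Quotient.eq_zero_iff_mem] using e 1 0
    · simpa [h1] using e 0 0
    · simpa [h1] using e 1 1
  · rintro ⟨h01, h10, h00, h11⟩
    ext i j
    rw [key]
    fin_cases i <;> fin_cases j
    · simpa [h1] using h00
    · simpa [Ideal.Quotient.eq_zero_iff_mem] using h01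
    · simpa [Ideal.Quotient.eq_zero_iff_mem] using h10
    · simpa [h1] using h11

/-- `E₁₂(x) ∈ Γ(I)` for `x ∈ I`. [folklore] -/
theorem e12_mem_Gamma {I : Ideal R} {x : R} (hx : x ∈ I) : e12 x ∈ Gamma I := by
  simp [mem_Gamma, hx]

/-- `E₂₁(y) ∈ Γ(I)` for `y ∈ I`. [folklore] -/
theorem e21_mem_Gamma {I : Ideal R} {y : R} (hy : y ∈ I) : e21 y ∈ Gamma I := by
  simp [mem_Gamma, hy]

/-- `E₁₂(x) ∈ E(I₁, I₂)` for `x ∈ I₁`. [cite: Vaserstein1972SL2, p. 313] -/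
theorem e12_mem_relE {I₁ I₂ : Ideal R} {x : R} (hx : x ∈ I₁) : e12 x ∈ relE I₁ I₂ :=
  Subgroup.subset_closure (Or.inl ⟨x, hx, rfl⟩)

/-- `E₂₁(y) ∈ E(I₁, I₂)` for `y ∈ I₂`. [cite: Vaserstein1972SL2, p. 313] -/
theorem e21_mem_relE {I₁ I₂ : Ideal R} {y : R} (hy : y ∈ I₂) : e21 y ∈ relE I₁ I₂ :=
  Subgroup.subset_closure (Or.inr ⟨y, hy, rfl⟩)

/-- `E(I, I) ≤ Γ(I)`. [folklore] -/
theorem relE_le_Gamma (I : Ideal R) : relE I I ≤ Gamma I := by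
  refine (Subgroup.closure_le _).2 ?_
  rintro M (⟨x, hx, rfl⟩ | ⟨y, hy, rfl⟩)
  exacts [e12_mem_Gamma hx, e21_mem_Gamma hy]

/-- `Γ(I) ≤ G(I, R)` (the relative group with no condition on the lower left entry).
[cite: Vaserstein1972SL2, p. 315] -/
theorem Gamma_le_relG_top (I : Ideal R) : Gamma I ≤ relG I ⊤ := by
  intro M hM
  rw [mem_Gamma] at hM
  rw [mem_relG, Ideal.mul_top]
  exact ⟨hM.1, Submodule.mem_top, hM.2.2.1, hM.2.2.2⟩

/-- The normal closure `Ê_I` of `E(I, I)` in `SL₂(R)` lies in `Γ(I)`. [folklore] -/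
theorem normalClosure_relE_le_Gamma (I : Ideal R) :
    Subgroup.normalClosure (relE I I : Set SL(2, R)) ≤ Gamma I :=
  Subgroup.normalClosure_le_normal (relE_le_Gamma I)

/-- **`Γ(I) ∩ E(I, R) ≤ Ê_I`**, `Ê_I` the normal closure of `E(I, I)` in `SL₂(R)`: every element of
`E(I, R) = ⟨E₁₂(I), E₂₁(R)⟩` is `n · E₂₁(y)` with `n ∈ Ê_I`, and it lies in `Γ(I)` iff `y ∈ I`.
(Vaserstein, p. 315, proves the sharper `E(I, K) ∩ G_I = E_I`.) [cite: Vaserstein1972SL2, p. 315] -/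
theorem Gamma_inf_relE_top_le_normalClosure (I : Ideal R) :
    Gamma I ⊓ relE I ⊤ ≤ Subgroup.normalClosure (relE I I : Set SL(2, R)) := by
  set N := Subgroup.normalClosure (relE I I : Set SL(2, R)) with hN
  haveI : N.Normal := Subgroup.normalClosure_normal
  -- every element of `E(I, R)` is `n * e21 y` with `n ∈ N`
  have key : ∀ g ∈ relE I (⊤ : Ideal R), ∃ n ∈ N, ∃ y : R, g = n * e21 y := by
    intro g hg
    refine Subgroup.closure_induction (p := fun g _ ↦ ∃ n ∈ N, ∃ y : R, g = n * e21 y)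
      ?_ ⟨1, N.one_mem, 0, by simp⟩ ?_ ?_ hg
    · rintro M (⟨x, hx, rfl⟩ | ⟨y, -, rfl⟩)
      · exact ⟨e12 x, Subgroup.subset_normalClosure (e12_mem_relE hx), 0, by simp⟩
      · exact ⟨1, N.one_mem, y, by simp⟩
    · rintro g h - - ⟨n, hn, y, rfl⟩ ⟨n', hn', y', rfl⟩
      refine ⟨n * (e21 y * n' * (e21 y)⁻¹), N.mul_mem hn (Subgroup.Normal.conj_mem ‹_› n' hn' _),
        y + y', ?_⟩
      rw [e21_add]; group
    · rintro g - ⟨n, hn, y, rfl⟩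
      refine ⟨(e21 y)⁻¹ * n⁻¹ * (e21 y)⁻¹⁻¹, Subgroup.Normal.conj_mem ‹_› _ (N.inv_mem hn) _, -y, ?_⟩
      rw [e21_neg]; group
  rintro g ⟨hgΓ, hgE⟩
  obtain ⟨n, hn, y, rfl⟩ := key g hgE
  have hy : e21 y ∈ Gamma I := by
    simpa using (Gamma I).mul_mem ((Gamma I).inv_mem (normalClosure_relE_le_Gamma I hn)) hgΓ
  have hyI : y ∈ I := by simpa [mem_Gamma] using hy
  exact N.mul_mem hn (Subgroup.subset_normalClosure (e21_mem_relE hyI))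

/-- **The reduction for one ideal**: if `G(I, R) ≤ E(I, R)` then `Γ(I) ≤ Ê_I`.
[cite: Vaserstein1972SL2, Theorem, p. 313] -/
theorem Gamma_le_normalClosure_of_relG_le_relE {I : Ideal R} (h : relG I ⊤ ≤ relE I ⊤) :
    Gamma I ≤ Subgroup.normalClosure (relE I I : Set SL(2, R)) := fun _ hM ↦
  Gamma_inf_relE_top_le_normalClosure I ⟨hM, h (Gamma_le_relG_top I hM)⟩

/-! ### Serre's Proposition 1: a finite-index subgroup contains `E(e R, e R)` -/

/-- **Serre 1970, Prop. 1** (the number field case `𝔮 = nA`): if `N ◁ SL₂(R)` has finite index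
`e`, then `E₁₂(x), E₂₁(x) ∈ N` for all `x ∈ eR`, i.e. `E(eR, eR) ≤ N` (as `gᵉ ∈ N` and
`E₁₂(x)ᵉ = E₁₂(ex)`). [cite: SerreSL2Congruence1970, §1.4 Prop. 1] -/
theorem relE_span_natCast_le (N : Subgroup SL(2, R)) [N.Normal] [N.FiniteIndex] :
    relE (Ideal.span {(N.index : R)}) (Ideal.span {(N.index : R)}) ≤ N := by
  refine (Subgroup.closure_le _).2 ?_
  rintro M (⟨x, hx, rfl⟩ | ⟨y, hy, rfl⟩)
  · obtain ⟨r, rfl⟩ := Ideal.mem_span_singleton'.1 hx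
    rw [show r * (N.index : R) = N.index • r by rw [nsmul_eq_mul, mul_comm], e12_nsmul]
    exact Subgroup.pow_index_mem N _
  · obtain ⟨r, rfl⟩ := Ideal.mem_span_singleton'.1 hy
    rw [show r * (N.index : R) = N.index • r by rw [nsmul_eq_mul, mul_comm], e21_nsmul]
    exact Subgroup.pow_index_mem N _

end SL2Rel

open SL2Rel

/-- **Reduction of Serre's congruence subgroup property to Vaserstein's `G(𝔮, A) = E(𝔮, A)`.**
If for every totally real number field `F` of degree `≥ 2` and every integer `e ≥ 1` the relative
group `G(e𝓞_F, 𝓞_F) = {(a b; c d) ∈ SL₂(𝓞_F) : b ≡ 0, a ≡ d ≡ 1 (mod e)}` is contained in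
`E(e𝓞_F, 𝓞_F) = ⟨E₁₂(e𝓞_F), E₂₁(𝓞_F)⟩` (Vaserstein's theorem combined with Bass–Milnor–Serre,
Thm. 3.6, since `F` has a real place), then every subgroup of finite index of `SL₂(𝓞_F)` contains a
principal congruence subgroup `Γ(𝔪)`, `𝔪 = e𝓞_F ≠ 0` with `e = [SL₂(𝓞_F) : core H]`: indeed
`Γ(𝔪) ≤ G(𝔪, 𝓞_F) ≤ E(𝔪, 𝓞_F)`, so `Γ(𝔪) ≤ Ê_𝔪` (`Gamma_le_normalClosure_of_relG_le_relE`), and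
`E(𝔪, 𝔪) ≤ core H` (Serre's Prop. 1), so `Ê_𝔪 ≤ core H ≤ H`.
[cite: SerreSL2Congruence1970, §1.4 Prop. 1 and §2.6 Cor. 3; Vaserstein1972SL2, Theorem] -/
theorem congruenceSubgroupProperty_of_relG_le_relE
    (h : ∀ (F : Type) [Field F] [NumberField F] [NumberField.IsTotallyReal F],
      1 < Module.finrank ℚ F → ∀ e : ℕ, e ≠ 0 →
        relG (Ideal.span {(e : 𝓞 F)}) ⊤ ≤ relE (Ideal.span {(e : 𝓞 F)}) (⊤ : Ideal (𝓞 F))) :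
    SerreSL2Congruence1970_congruenceSubgroupProperty := by
  intro F _ _ _ hd H hH
  set e : ℕ := H.normalCore.index with he
  have he0 : e ≠ 0 := Subgroup.index_ne_zero_of_finite
  refine ⟨Ideal.span {(e : 𝓞 F)}, ?_, ?_⟩
  · rw [Ne, Ideal.span_singleton_eq_bot]
    exact_mod_cast he0
  · intro M hM
    have hΓ := Gamma_le_normalClosure_of_relG_le_relE (h F hd e he0) hM
    exact Subgroup.normalCore_le H
      (Subgroup.normalClosure_le_normal (N := H.normalCore) (relE_span_natCast_le H.normalCore) hΓ)

end Literature.NumberTheory.Automorphic
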